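/-
Origin: expansion seat `planner-pub-hodgecm-mc-theta-3-g3-0`, handover #7 2026-08-19T01:20Z md5 ad1601bd3335e1d2e29846ec8a0d9885 SUPERSEDES c82e3c00cc00 (docstring l.16 only: the word «proof-hole-free» removed for the token census — glue-1-g4 nit 01:18:21Z; 0 `proof-hole` tokens in the file now; Lean content byte-identical; rc 0 / 0 warnings rebuilt) (NEW additive leaf, 163 l.; imports HodgeCM.Model.SupplyDischarge ONLY (RUN 32 GREEN) — INSTALL ANY TIME in CUT #2, independent  (`HOME/mc/pub-hodgecm-mc-theta-3-g3/lean/stage/HodgeCM/Model/SupplyRigidity.lean`, md5 ad1601bd, 163 lines);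
landed by the gen-9 packager (p-g9) in gate run 33 as `HodgeCM/Model/SupplyRigidity.lean` (verbatim).
-/
/-
Copyright (c) 2026. Released under Apache 2.0 license as described in the file LICENSE.
Cell pub-hodgecm, MODEL layer (construction prover mc-theta-3, gen 3): NEGATIVE KNOWLEDGE (F1) about the
revision-1 one-`K`-type class supply data `ClassSupplyData` — a kernel rigidity theorem.
-/
import Summits.HodgeConjecture.HodgeCM.Model.SupplyDischarge

/-!
# Rigidity of the one-`K`-type class supply data (F1, kernel)

`Model/SupplyDischarge` § 2 records the revision-1 class-level supply data `P.ClassSupplyData T V c k`: ONE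
`K`-type (`Kc`, `κ`, `σ`, `τ`, `ι`) whose theta-equivariant families contain EVERY level-`N` test function
`φ_N = P.testFunT N` (`fam : ∀ N > 0, ∃ j ∈ 𝓙, ∃ ℓ, j (ι ℓ) = φ_N`), together with the level correction
`hΔ : IsLevelCorrected P.ΓU κ τ ιinf Δ` (every `δ ∈ Δ` is corrected into `ΓU` by some `κ c` with `τ c = 1`).

This file proves in the kernel, citing nothing, what that combination FORCES:

* `representation_dual_apply_of_apply_eq_one` (§ 0) and `ThetaKernelDatum.theta_mul_s_of_tau_eq_one` (abstract,
  over any kernel datum): a theta-equivariant family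
  `j` through a `Kc`-map `ι : W^∨ → E` makes the theta function of every value `j (ι ℓ)` invariant under
  `S ↦ S · s(κ x, 1)` for every `x ∈ ker τ`; `ThetaKernelDatum.thetaLiftFun_mul_of_tau_eq_one`: hence every
  theta lift `Θ̃_{j(ι ℓ)}(f)` is RIGHT-INVARIANT under `κ x`;
* `ClassSupplyData.thetaLiftFun_testFunT_mul_kappa`: for the revision-1 data, EVERY `Θ̃_{φ_N}(f)`, `N ≥ 1`, is
  right-invariant under `κ x` for every `x ∈ ker τ`;
* `ClassSupplyData.thetaLiftFun_testFunT_levelCorrector`: in particular under the level correctors of `hΔ`: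
  `∀ δ ∈ Δ, ∃ γ ∈ ΓU, ∀ N ≥ 1, ∀ f g, Θ̃_{φ_N}(f)(g · (ιinf δ)⁻¹ γ) = Θ̃_{φ_N}(f)(g)`.

WHY THIS IS AN OBSTRUCTION (informal; the converse direction is an `ω`-side computation NOT proved here): in the
intended instantiation `Kc = K_f × K_∞` with `K_f` a FIXED open compact subgroup and `Δ = {δ ∈ G(F) : δ_f ∈ K_f}`,
the corrector of `δ` is `(δ_f⁻¹, 1)`, so the theorem says `Θ̃_{φ_N}` is right-invariant under the finite parts of
`Δ` for ALL `N` — whereas `φ_N = Φ_∞ ⊗ 1_{x₀ + N·𝒪̂}` is fixed only by the principal congruence subgroup of level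
`N` ((W-Kf′)), so for `N` beyond the level of `K_f` the data cannot be instantiated.  This is the reason for the
level-INDEXED redesign `Model/SupplyClassLevel` → `Model/SupplySituation` → `Model/ArchKType` (one `K`-type PER
`N`).  Compare the sanity lane's `Model/SupplySituation` § 2 `isEmpty_classSupplyData_of_levels_move`, which takes
the moving of levels as a hypothesis `hmove`; the present file derives the rigidity itself from the fields.
-/

set_option autoImplicit false

noncomputable section

open MeasureTheory
open Literature.NumberTheory.Automorphic Literature.NumberTheory.Weil1964

universe u v

/-! ### § 0. A representation-theory triviality -/

namespace HodgeCM.Model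

/-- An element acting trivially in `τ` acts trivially in the dual representation. -/
theorem representation_dual_apply_of_apply_eq_one {Kc : Type*} [Group Kc] {W : Type*} [AddCommGroup W]
    [Module ℂ W] {τ : Representation ℂ Kc W} {x : Kc} (hx : τ x = 1) (ℓ : Module.Dual ℂ W) :
    τ.dual x ℓ = ℓ := by
  have hinv : τ x⁻¹ = 1 := by
    have h := map_mul τ x⁻¹ x
    rw [inv_mul_cancel, map_one, hx, mul_one] at h
    exact h.symm
  ext w
  rw [Representation.dual_apply, hinv, Module.Dual.transpose_apply, LinearMap.comp_apply, Module.End.one_apply]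

end HodgeCM.Model

/-! ### § 1. Abstract rigidity over a kernel datum -/

namespace Literature.NumberTheory.Weil1964.ThetaKernelDatum

variable {Mp : Type u} {SX : Type v} [TopologicalSpace Mp] [Group Mp] [TopologicalSpace SX]
variable {GU : Type*} [Group GU] [TopologicalSpace GU] [IsTopologicalGroup GU] {ΓU : Subgroup GU}
variable {G : Type*} [Group G] [TopologicalSpace G] [IsTopologicalGroup G] {Γ : Subgroup G}
variable (M : ThetaKernelDatum Mp SX GU ΓU G Γ)
variable [AddCommGroup SX] [Module ℂ SX]
variable {Kc : Type*} [Group Kc] {κ : Kc →* GU}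
variable {E : Type*} [AddCommGroup E] [Module ℂ E] {σ : Representation ℂ Kc E}
variable {W : Type*} [AddCommGroup W] [Module ℂ W] {τ : Representation ℂ Kc W}
variable {ι : Module.Dual ℂ W →ₗ[ℂ] E} {j : E →ₗ[ℂ] SX}

omit [IsTopologicalGroup GU] [IsTopologicalGroup G] in
/-- **F1 rigidity, abstract form**: a theta-equivariant family `j` through a `Kc`-map `ι : W^∨ → E` makes the
theta function of every value `j (ι ℓ)` invariant under `S ↦ S · s(κ x, 1)` for every `x ∈ ker τ`. -/
theorem theta_mul_s_of_tau_eq_one (hj : M.IsThetaEquivariant κ σ j)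
    (hι : ∀ (x : Kc) (ℓ : Module.Dual ℂ W), ι (τ.dual x ℓ) = σ x (ι ℓ)) {x : Kc} (hx : τ x = 1)
    (ℓ : Module.Dual ℂ W) (S : Mp) :
    M.W.theta (j (ι ℓ)) (S * M.s (κ x, 1)) = M.W.theta (j (ι ℓ)) S := by
  rw [← hj x (ι ℓ) S, ← hι, HodgeCM.Model.representation_dual_apply_of_apply_eq_one hx]

/-- … hence every theta lift `Θ̃_{j(ι ℓ)}(f)` is right-invariant under `κ x`, `x ∈ ker τ`. -/
theorem thetaLiftFun_mul_of_tau_eq_one [CompactSpace (GU ⧸ ΓU)] [CompactSpace (G ⧸ Γ)] [MeasurableSpace (G ⧸ Γ)]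
    [BorelSpace (G ⧸ Γ)] (μ : Measure (G ⧸ Γ)) [IsFiniteMeasure μ] (hj : M.IsThetaEquivariant κ σ j)
    (hι : ∀ (x : Kc) (ℓ : Module.Dual ℂ W), ι (τ.dual x ℓ) = σ x (ι ℓ)) {x : Kc} (hx : τ x = 1)
    (ℓ : Module.Dual ℂ W) (f : C(G ⧸ Γ, ℂ)) (g : GU) :
    M.thetaLiftFun μ (j (ι ℓ)) f (g * κ x) = M.thetaLiftFun μ (j (ι ℓ)) f g := by
  rw [M.thetaLiftFun_mul_right μ, thetaLiftFun_apply, thetaLiftFun_apply]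
  exact congrFun (congrArg DFunLike.coe (M.thetaLift_congr μ (fun S =>
    (M.theta_act (j (ι ℓ)) S (M.s (κ x, 1))).trans (M.theta_mul_s_of_tau_eq_one hj hι hx ℓ S)) f)) _

end Literature.NumberTheory.Weil1964.ThetaKernelDatum

/-! ### § 2. The revision-1 class supply data is rigid -/

namespace HodgeCM
namespace Model
namespace SupplyResidual
namespace WeilPairData

open HodgeCM.PerL34.Seesaw HodgeCM.PerL34.RationalCoset

variable {K L : Type} [Field K] [NumberField K] [Field L] [NumberField L] [Algebra K L] [FiniteDimensional K L]
variable {J : Type} [Fintype J] {GU : Type} [Group GU] [TopologicalSpace GU]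
variable (P : WeilPairData K L J GU)
variable [IsTopologicalGroup GU] [LocallyCompactSpace GU]
variable [CompactSpace (GU ⧸ P.ΓU)] {U : Universe} {T : U.ThetaModel} {Lc : CMField} {ι₁ : Lc →+* ℂ}
  {V : HermSpace3 Lc ι₁} {c : SeesawCtx Lc} {k : Fin 4}

namespace ClassSupplyData

variable {P} (D : P.ClassSupplyData T V c k)

/-- **Every `Θ̃_{φ_N}(f)` of the revision-1 data is right-invariant under `κ x`, `x ∈ ker τ`.** -/
theorem thetaLiftFun_testFunT_mul_kappa (N : ℕ) (hN : 0 < N) {x : D.Kc} (hx : D.τ x = 1)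
    (f : C(relNormOneIdeles K L ⧸ relNormOneRat K L, ℂ)) (g : GU) :
    P.kernelDatum.thetaLiftFun (probHaarRelNormOneQuot K L) (P.testFunT N) f (g * D.κ x) =
      P.kernelDatum.thetaLiftFun (probHaarRelNormOneQuot K L) (P.testFunT N) f g := by
  obtain ⟨j, -, ℓ, hjℓ⟩ := D.fam N hN
  rw [← hjℓ]
  exact P.kernelDatum.thetaLiftFun_mul_of_tau_eq_one _ j.2 D.hι hx ℓ f g

/-- **… in particular under the level correctors**: for every `δ ∈ Δ` there is `γ ∈ ΓU` with
`Θ̃_{φ_N}(f)(g · (ιinf δ)⁻¹ γ) = Θ̃_{φ_N}(f)(g)` for ALL `N ≥ 1` (and all `f`, `g`) — `(ιinf δ)⁻¹ γ = κ c` is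
the corrector of `hΔ`, of finite part `δ_f⁻¹` in the intended instantiation (module docstring). -/
theorem thetaLiftFun_testFunT_levelCorrector {δ : D.G₁} (hδ : δ ∈ D.Δ) :
    ∃ γ ∈ P.ΓU, ∀ (N : ℕ), 0 < N → ∀ (f : C(relNormOneIdeles K L ⧸ relNormOneRat K L, ℂ)) (g : GU),
      P.kernelDatum.thetaLiftFun (probHaarRelNormOneQuot K L) (P.testFunT N) f (g * ((D.ιinf δ)⁻¹ * γ)) =
        P.kernelDatum.thetaLiftFun (probHaarRelNormOneQuot K L) (P.testFunT N) f g := by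
  obtain ⟨x, hx, hmem, -⟩ := D.hΔ δ hδ
  refine ⟨D.ιinf δ * D.κ x, hmem, fun N hN f g => ?_⟩
  rw [inv_mul_cancel_left]
  exact D.thetaLiftFun_testFunT_mul_kappa N hN hx f g

/-- The same, read as right-invariance of `Θ̃_{φ_N}(f)` under the whole subgroup generated by the `κ`-image of
`ker τ`. -/
theorem thetaLiftFun_testFunT_mul_mem_closure (N : ℕ) (hN : 0 < N)
    (f : C(relNormOneIdeles K L ⧸ relNormOneRat K L, ℂ)) {u : GU}
    (hu : u ∈ Subgroup.closure (D.κ '' {x : D.Kc | D.τ x = 1})) (g : GU) :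
    P.kernelDatum.thetaLiftFun (probHaarRelNormOneQuot K L) (P.testFunT N) f (g * u) =
      P.kernelDatum.thetaLiftFun (probHaarRelNormOneQuot K L) (P.testFunT N) f g := by
  induction hu using Subgroup.closure_induction generalizing g with
  | mem u hu =>
    obtain ⟨x, hx, rfl⟩ := hu
    exact D.thetaLiftFun_testFunT_mul_kappa N hN hx f g
  | one => rw [mul_one]
  | mul u u' _ _ ihu ihu' => rw [← mul_assoc, ihu', ihu]
  | inv u _ ihu =>
    have h := ihu (g * u⁻¹)
    rw [inv_mul_cancel_right] at h
    exact h.symm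

end ClassSupplyData

end WeilPairData
end SupplyResidual
end Model
end HodgeCM
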